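import Literature.AlgebraicGeometry.Hyperkaehler.GeneralizedKummerTypeTranslationGroup
import Literature.AlgebraicGeometry.Hyperkaehler.K3HilbertType
import HarnessLib

/-!
# The Kummer involution and its fixed fourfold `W_X ⊂ X` on a variety of `Kum⁴`-type (Floccari 2026, Lemma 4.2 / Prop. 4.6) — NAMED FACT

Layer `Literature/AlgebraicGeometry/Hyperkaehler`.  CITE record for the cell `hodge-kum4` (ladder
HodgeAV, rung H3 = the Hodge conjecture for every smooth projective variety of `Kum⁴`-type; seat p2;
graded input list HOME/lit/LIT-GRADES-r1.md rows L3.1, L3.2; referee REF-AUDIT-2 R3): on every smooth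
projective `X` of `Kum⁴`-type there is an involution `ι ∈ Aut₀(X) ∖ Γ(X)` (`Aut₀(X) = Γ(X) ⋊ ⟨ι⟩ ≅
(ℤ/5)⁴ ⋊ ℤ/2`, `ι` inverting `Γ(X)`), whose fixed locus has a UNIQUE component of maximal dimension `4`,
a hyper-Kähler fourfold `W_X` of `K3^[2]`-type (at the Kummer point: `Km(A)^[2] ↪ K⁴(A)`), all other
components being K3 surfaces or points.  The classes of the `625` translates `g(W_X)`, `g ∈ Γ(X)`
(the maximal fixed components of the `625` involutions `g ι g⁻¹ = ι g⁻²` of `Aut₀(X) ∖ Γ(X)` — for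
`n + 1 = 5` odd every such involution is `Γ`-conjugate to `ι`, as `ι ∘ t_x = t_y ∘ ι ∘ t_{-y}` with
`2y = -x`; referee R3 / literature flag F6) are the input of lemma L3 of the cell's blueprint, and
`W_X` is the unique half-dimensional fixed component entering the `G`-signature theorem
(`[W_X]² = Sign(ι, X)`).

## Sources (read: arXiv text `paper:arxiv-2501.02315`, pp. p0010, p0014; `paper:arxiv-2308.02267` p0006)

S. Floccari, *K3 surfaces associated with varieties of generalized Kummer type*, Geom. Topol. 30 (2026)
1129–1154 [`Floccari2026`, REFEREED]:
* Definition 4.1 / Lemma 4.2 (p0010 L13–L33), verbatim: "If `n` is even, `n = 2m`, we let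
  `ι : W ↪ Kⁿ(A)` be the strict transform of the image of `f' : A^m → A_0^{(2m+1)}` […] **Lemma 4.2.**
  For any `n ≥ 2`, the subvariety `W ⊂ Kⁿ(A)` is the unique component of maximal dimension of the fixed
  locus of `−1` acting on `Kⁿ(A)`. Moreover, if `n = 2m` […], then `f'` […] induces an embedding
  `ι : Km(A)^[m] ↪ K^{2m}(A)` […] with image `W`. *Proof.* The lemma is proven by
  Kamenova–Mongardi–Oblomkov [KMO]. They show in [KMO] that the fixed locus of `−1` on `Kⁿ(A)` is the
  union of components which are varieties of `K3^[k]`-type or points, and that there exists a unique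
  component of maximal dimension `2m` for `n = 2m−1` or `n = 2m`."
* Proposition 4.6 (p0014 L11–L22), verbatim: "Let `𝒦 → B` be a smooth proper family of complex
  manifolds of `Kumⁿ`-type over a connected manifold `B`, such that for some `0 ∈ B` we have
  `𝒦_0 = Kⁿ(A)` […]. Then, up to a finite étale base-change, there exist a smooth and proper family
  `𝒲 → B` of manifolds of `K3^[m]`-type with `𝒲_0 = Km(A)^[m]` and a closed embedding `ι : 𝒲 ↪ 𝒦`
  over `B` extending `ι_0`."; its proof: "`Aut₀(Kⁿ(A)) = A_{n+1} ⋊ ⟨−1⟩`; thus, any `K` of `Kumⁿ`-type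
  admits an action of `Aut₀(K) ≅ (ℤ/(n+1)ℤ)⁴ ⋊ ℤ/2ℤ` […] the action of `−1` […] extends to a fibrewise
  automorphism […] By [Camere], each component `𝒴` of the fixed locus `𝒦^{(−1)}` is a smooth and proper
  family `𝒴 → B` of symplectic manifolds, or just the image of a section"; and after it: "the
  cohomology class `[ι(Km(A)^[m])]` remains algebraic, and in particular a Hodge class, on any
  deformation of `Kⁿ(A)`."
* S. Floccari, arXiv:2308.02267 [`Floccari2023`], §2.5 (p0006): "`Aut₀(K³(A)) = A₄ ⋊ ⟨−1⟩`, where the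
  second factor acts on the first as the inverse […] by [oguiso2020no], the involution `−1` acts as
  multiplication by `−1` on the third cohomology."
* L. Kamenova, G. Mongardi, A. Oblomkov, Bull. LMS 54 (2022) [`KamenovaMongardiOblomkov2022`] with the
  erratum [`KamenovaMongardiOblomkov2025`]: only the TOP-DIMENSIONAL statement (uniqueness of the
  `4`-dimensional component) enters, through Floccari's Lemma 4.2, and it is unaffected by the
  erratum (literature flag F6); the erratum's lower-dimensional census is NOT used: "the other
  components have dimension `≤ 2`" follows from uniqueness of the top component together with
  even-dimensionality of the fixed components of a symplectic involution (Camere 2012, as cited in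
  the proof of Prop. 4.6), and their smoothness is the classical fact that the fixed scheme of a
  finite group acting on a smooth variety in characteristic `0` is smooth (Cartan; Iversen 1972).

## Rendering (tree carriers) and faithfulness

For `X` smooth projective of dimension `8` of `Kum⁴`-type (`n = 4 = 2m`, `m = 2`):
* `ι : Aut X` with `ι * ι = 1`, `ι^* = 1` on `H²(X(ℂ); ℂ)` (so `ι ∈ Aut₀`), `ι^* = −1` on
  `H³(X(ℂ); ℂ)` (Oguiso; hence `ι ∉ Γ(X) = autFixingH2H3 X`), and `ι g ι = g⁻¹` for `g ∈ Γ(X)` ("acts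
  on the first as the inverse").  Any element of `Aut₀(X) ∖ Γ(X)` will do: for `n + 1 = 5` odd they
  are the `625` involutions `ι t_x = t_y ι t_{−y}` (`2y = −x`, `2 ∈ (ℤ/5)ˣ`), all `Γ`-conjugate to the
  transported `−1`, so the statement does not depend on the choice (literature flag F6 / referee R3);
* `W : Motives.SchemeOver ℂ` smooth projective of dimension `4` (`Motives.IsSmoothProjective 4 W`) of
  `K3^[2]`-type (`IsOfK3HilbertType 2 W`, file `K3HilbertType`) with a closed immersion `i : W ⟶ X`
  (`IsClosedImmersion i.left`) fixed by `ι` (`i ≫ ι.hom = i`);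
* "unique component of maximal dimension; the others are K3 surfaces or points": the fixed point
  set of `ι(ℂ)` on `X(ℂ)` is the DISJOINT union of the image of `W(ℂ)` and of the images of finitely
  many smooth projective `G k` of dimension `dG k ≤ 2`, closed in `X` — exactly the decomposition
  consumed by the tree's `G`-signature record
  `HodgeTheory.Hirzebruch1969_gSignature_involution_halfDimFixedLocus` (file
  `HodgeTheory/HolomorphicInvolutionGSignature`, with `J = Unit`, `F () = W`, `dG k < 4`).  Smoothness
  and projectivity of the components: fixed scheme of a finite group on a smooth projective variety
  (Cartan; Iversen 1972), even-dimensional (Camere, as cited in the proof of Prop. 4.6); `≤ 2` by the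
  uniqueness of the `4`-dimensional component.  Stated for `n = 4` only.
  `-- TODO(general form)`: `n = 2m` or `2m − 1`, `W` of `K3^[m]`-type, `Γ ≅ (ℤ/(n+1))⁴`.

## What is NOT here

The isomorphism `W ≅ Km(A)^[2]` at the Kummer point and Prop. 4.3 (`ι^*` on `H²` multiplies the form by
`2`); the cycle class of `W` and its self-intersection (the `G`-signature theorem, separate record); the
intersection numbers `[W]·[gW]`; any proof.

## Appended (cell `hodge-kum4`, seat p2, 2026-08-25): the datum as a predicate

`IsKummerFixedDatum X ι W i` — the body of the named fact WITHOUT its leading existential (a DEFINITION,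
no new claim), so that consumers can quantify over "a Kummer fixed datum `(ι, W, i)` on `X`" (the cell's
residual item I1R is stated on it; planner sketch HOME/plan/route/v22V/I1R, referee REF-AUDIT-7 §8);
`Floccari2026_fixedFourfold_kum4Type_iff` (`Iff.rfl`) and the projections `IsKummerFixedDatum.*`.
-/

noncomputable section

open CategoryTheory AlgebraicGeometry
open Literature.AlgebraicGeometry.HodgeTheory

namespace Literature.AlgebraicGeometry.Hyperkaehler

/-- **Floccari 2026, Lemma 4.2 / Prop. 4.6 (with `Aut₀ = Γ ⋊ ⟨ι⟩`, Boissière–Nieper-Wißkirchen–Sarti,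
Hassett–Tschinkel, Oguiso, Kamenova–Mongardi–Oblomkov, Camere): the Kummer involution and its fixed
fourfold on a smooth projective variety of `Kum⁴`-type.**  There are `ι ∈ Aut X` with `ι² = 1`,
`ι^* = 1` on `H²`, `ι^* = −1` on `H³`, `ι g ι = g⁻¹` for all `g ∈ Γ(X)`, and a smooth projective
`W` of dimension `4` of `K3^[2]`-type with an `ι`-fixed closed immersion `i : W ⟶ X`, such that the
fixed point set of `ι(ℂ)` is the disjoint union of `i(W(ℂ))` and of the images of finitely many
smooth projective closed subvarieties of dimension `≤ 2` (module docstring for the verbatim statements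
and the rendering).  A THEOREM in print, unproved in the tree. [cite: Floccari2026, §4.1 Lemma 4.2 and §4.4 Prop. 4.6]
[cite: Floccari2023, §2.5] -/
def Floccari2026_fixedFourfold_kum4Type : Prop :=
  ∀ ⦃X : Motives.SchemeOver ℂ⦄, Motives.IsSmoothProjective 8 X → IsOfGeneralizedKummerType 4 X →
    ∃ (ι : Aut X) (W : Motives.SchemeOver ℂ) (i : W ⟶ X),
      ι * ι = 1 ∧ complexBetti.map ι.hom 2 = 𝟙 _ ∧ complexBetti.map ι.hom 3 = -𝟙 _ ∧
      (∀ g : Aut X, g ∈ autFixingH2H3 X → ι * g * ι = g⁻¹) ∧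
      Motives.IsSmoothProjective 4 W ∧ IsOfK3HilbertType 2 W ∧ IsClosedImmersion i.left ∧
      i ≫ ι.hom = i ∧
      -- the other fixed components: finitely many smooth projective `G k` of dimension `≤ 2`,
      -- closed in `X`, pairwise disjoint and disjoint from `W`, covering the rest of `Fix(ι(ℂ))`
      ∃ (K : Type) (_ : Fintype K) (G : K → Motives.SchemeOver ℂ) (dG : K → ℕ)
        (iG : ∀ k, G k ⟶ X),
        (∀ k, Motives.IsSmoothProjective (dG k) (G k)) ∧ (∀ k, dG k ≤ 2) ∧
        (∀ k, IsClosedImmersion (iG k).left) ∧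
        (∀ k k', k ≠ k' →
          Disjoint (Set.range (Motives.AlgPoints.mapContinuous (L := ℂ) (iG k)))
            (Set.range (Motives.AlgPoints.mapContinuous (L := ℂ) (iG k')))) ∧
        (∀ k, Disjoint (Set.range (Motives.AlgPoints.mapContinuous (L := ℂ) i))
          (Set.range (Motives.AlgPoints.mapContinuous (L := ℂ) (iG k)))) ∧
        {x : Motives.ComplexPoints X | Motives.AlgPoints.mapContinuous (L := ℂ) ι.hom x = x} =
          Set.range (Motives.AlgPoints.mapContinuous (L := ℂ) i) ∪
            ⋃ k, Set.range (Motives.AlgPoints.mapContinuous (L := ℂ) (iG k))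
-- TODO(general form): `n = 2m` or `2m - 1`, `W` of `K3^[m]`-type, codimension of the other components.

namespace Floccari2026_fixedFourfold_kum4Type

variable (h : Floccari2026_fixedFourfold_kum4Type) {X : Motives.SchemeOver ℂ}
  (hX : Motives.IsSmoothProjective 8 X) (hK : IsOfGeneralizedKummerType 4 X)
include h hX hK

/-- The Kummer involution: an `ι ∈ Aut X` with `ι² = 1`, trivial on `H²`, `−1` on `H³`, inverting
`Γ(X)` by conjugation. [cite: Floccari2026, §4.4 Prop. 4.6 (proof)] [cite: Floccari2023, §2.5] -/
theorem exists_involution :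
    ∃ ι : Aut X, ι * ι = 1 ∧ complexBetti.map ι.hom 2 = 𝟙 _ ∧ complexBetti.map ι.hom 3 = -𝟙 _ ∧
      ∀ g : Aut X, g ∈ autFixingH2H3 X → ι * g * ι = g⁻¹ := by
  obtain ⟨ι, -, -, h1, h2, h3, h4, -⟩ := h hX hK
  exact ⟨ι, h1, h2, h3, h4⟩

/-- Points of the image of the fixed fourfold are fixed by the involution (`i ≫ ι = i`).
[cite: Floccari2026, §4.1 Lemma 4.2] -/
theorem exists_fixedFourfold :
    ∃ (ι : Aut X) (W : Motives.SchemeOver ℂ) (i : W ⟶ X), ι * ι = 1 ∧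
      Motives.IsSmoothProjective 4 W ∧ IsOfK3HilbertType 2 W ∧ IsClosedImmersion i.left ∧
      ∀ P : Motives.ComplexPoints W,
        Motives.AlgPoints.map (L := ℂ) ι.hom (Motives.AlgPoints.map (L := ℂ) i P) =
          Motives.AlgPoints.map (L := ℂ) i P := by
  obtain ⟨ι, W, i, h1, -, -, -, hW, hK3, hi, hfix, -⟩ := h hX hK
  refine ⟨ι, W, i, h1, hW, hK3, hi, fun P => ?_⟩
  rw [← Motives.AlgPoints.map_comp_apply, hfix]

end Floccari2026_fixedFourfold_kum4Type

/-! ### The Kummer fixed datum as a predicate (the body of the fact, no new claim) -/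

/-- **The Kummer fixed datum `(ι, W, i)` on `X`** — the body of `Floccari2026_fixedFourfold_kum4Type`
VERBATIM, without its leading existential (a definition, not a claim): `ι ∈ Aut X` is an involution,
trivial on `H²(X(ℂ); ℂ)`, `−1` on `H³(X(ℂ); ℂ)`, inverting `Γ(X) = autFixingH2H3 X` by conjugation;
`W` is smooth projective of dimension `4`, of `K3^[2]`-type, with an `ι`-fixed closed immersion
`i : W ⟶ X`; and the fixed point set of `ι(ℂ)` on `X(ℂ)` is the disjoint union of `i(W(ℂ))` and of the
images of finitely many smooth projective closed subvarieties of dimension `≤ 2` (so `W` is THE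
`4`-dimensional fixed component, Lemma 4.2, and `ι ∈ Aut₀ ∖ Γ` is `Γ`-conjugate to the transported
`−1`). [cite: Floccari2026, §4.1 Lemma 4.2 and §4.4 Prop. 4.6] [cite: Floccari2023, §2.5] -/
def IsKummerFixedDatum (X : Motives.SchemeOver ℂ) (ι : Aut X) (W : Motives.SchemeOver ℂ) (i : W ⟶ X) :
    Prop :=
  ι * ι = 1 ∧ complexBetti.map ι.hom 2 = 𝟙 _ ∧ complexBetti.map ι.hom 3 = -𝟙 _ ∧
      (∀ g : Aut X, g ∈ autFixingH2H3 X → ι * g * ι = g⁻¹) ∧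
      Motives.IsSmoothProjective 4 W ∧ IsOfK3HilbertType 2 W ∧ IsClosedImmersion i.left ∧
      i ≫ ι.hom = i ∧
      ∃ (K : Type) (_ : Fintype K) (G : K → Motives.SchemeOver ℂ) (dG : K → ℕ)
        (iG : ∀ k, G k ⟶ X),
        (∀ k, Motives.IsSmoothProjective (dG k) (G k)) ∧ (∀ k, dG k ≤ 2) ∧
        (∀ k, IsClosedImmersion (iG k).left) ∧
        (∀ k k', k ≠ k' →
          Disjoint (Set.range (Motives.AlgPoints.mapContinuous (L := ℂ) (iG k)))
            (Set.range (Motives.AlgPoints.mapContinuous (L := ℂ) (iG k')))) ∧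
        (∀ k, Disjoint (Set.range (Motives.AlgPoints.mapContinuous (L := ℂ) i))
          (Set.range (Motives.AlgPoints.mapContinuous (L := ℂ) (iG k)))) ∧
        {x : Motives.ComplexPoints X | Motives.AlgPoints.mapContinuous (L := ℂ) ι.hom x = x} =
          Set.range (Motives.AlgPoints.mapContinuous (L := ℂ) i) ∪
            ⋃ k, Set.range (Motives.AlgPoints.mapContinuous (L := ℂ) (iG k))

/-- The named fact is literally "every smooth projective `X` of `Kum⁴`-type carries a Kummer fixed
datum" (`Iff.rfl`). [cite: Floccari2026, §4.1 Lemma 4.2 and §4.4 Prop. 4.6] -/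
theorem Floccari2026_fixedFourfold_kum4Type_iff :
    Floccari2026_fixedFourfold_kum4Type ↔
      ∀ ⦃X : Motives.SchemeOver ℂ⦄, Motives.IsSmoothProjective 8 X → IsOfGeneralizedKummerType 4 X →
        ∃ (ι : Aut X) (W : Motives.SchemeOver ℂ) (i : W ⟶ X), IsKummerFixedDatum X ι W i :=
  Iff.rfl

namespace IsKummerFixedDatum

variable {X : Motives.SchemeOver ℂ} {ι : Aut X} {W : Motives.SchemeOver ℂ} {i : W ⟶ X}
  (h : IsKummerFixedDatum X ι W i)
include h

/-- `ι² = 1`. [cite: Floccari2026, §4.4 Prop. 4.6 (proof)] -/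
theorem mul_self : ι * ι = 1 := h.1

/-- `ι^* = 1` on `H²`. [cite: Floccari2026, §4.4 Prop. 4.6 (proof)] -/
theorem map_two : complexBetti.map ι.hom 2 = 𝟙 _ := h.2.1

/-- `ι^* = −1` on `H³`. [cite: Floccari2023, §2.5] -/
theorem map_three : complexBetti.map ι.hom 3 = -𝟙 _ := h.2.2.1

/-- `ι g ι = g⁻¹` for `g ∈ Γ(X)`. [cite: Floccari2023, §2.5] -/
theorem conj_eq_inv (g : Aut X) (hg : g ∈ autFixingH2H3 X) : ι * g * ι = g⁻¹ := h.2.2.2.1 g hg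

/-- `W` is smooth projective of dimension `4`. [cite: Floccari2026, §4.1 Lemma 4.2] -/
theorem isSmoothProjective : Motives.IsSmoothProjective 4 W := h.2.2.2.2.1

/-- `W` is of `K3^[2]`-type. [cite: Floccari2026, §4.1 Lemma 4.2] -/
theorem isOfK3HilbertType : IsOfK3HilbertType 2 W := h.2.2.2.2.2.1

/-- `i` is a closed immersion. [cite: Floccari2026, §4.1 Lemma 4.2] -/
theorem isClosedImmersion : IsClosedImmersion i.left := h.2.2.2.2.2.2.1

/-- `i ≫ ι = i`: the fourfold is pointwise fixed. [cite: Floccari2026, §4.1 Lemma 4.2] -/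
theorem comp_hom : i ≫ ι.hom = i := h.2.2.2.2.2.2.2.1

/-- Points of the image of `W` are fixed by `ι(ℂ)`. [cite: Floccari2026, §4.1 Lemma 4.2] -/
theorem mapContinuous_apply (P : Motives.ComplexPoints W) :
    Motives.AlgPoints.mapContinuous (L := ℂ) ι.hom (Motives.AlgPoints.mapContinuous (L := ℂ) i P) =
      Motives.AlgPoints.mapContinuous (L := ℂ) i P := by
  rw [Motives.AlgPoints.mapContinuous_apply, Motives.AlgPoints.mapContinuous_apply,
    ← Motives.AlgPoints.map_comp_apply, h.comp_hom]

end IsKummerFixedDatum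

end Literature.AlgebraicGeometry.Hyperkaehler

end
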